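import Summits.BirchSwinnertonDyer.BirchSwinnertonDyer.Theorems.PrintX11aLowerHalfNonSurjEndpoint
import Summits.BirchSwinnertonDyer.Rank1Residual.X11a.ChainAnyLevel
import Summits.BirchSwinnertonDyer.Rank1Residual.GaloisImage.MultiplicativeLargeImage
import Summits.BirchSwinnertonDyer.BirchSwinnertonDyer.Theorems.ErratumRoadFiveNonSurjCornerBranchesDefs
import Literature.NumberTheory.EllipticCurves.Wan2015RationalMainConjecture
import Literature.NumberTheory.EllipticCurves.PAdicLFunctionMultiplicativeInterpolation
import HarnessLib

/-!
# Crux `X11aLowerHalf` (item stmt-BirchSwinnertonDyer-19064), NON-SURJECTIVE sub-leaf, `p ≥ 5`: the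
# EPW ∕ Wan Hida-family chain WITHOUT the surjectivity of `ρ̄_{E,p}` — part A, the chain core
# (`--supports stmt-BirchSwinnertonDyer-19064`; seat bsd-line-er5-p2 = -w3 width seat of the 19064
# line r1 «off-unit», registered stub `stub_lowerNonSurjDeep`; part B = `…NonSurjDoors.lean`)

HONEST FRAMING. Theorems only; no definition, no `sorry`; ONE new statement-only Literature named fact is
CONSUMED (`Wan2015.thm4_rational_weightK_member_of_bdd_ofLevel_irred`, proposal p608784, an INSTANCE of a
printed theorem under its printed hypothesis; nothing asserted). Nothing here closes the crux `X11aLowerHalf`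
or the registered stub `stub_lowerNonSurjDeep` (`∀` non-surjective X11a pairs off the unit cells —
OPEN class-wide); everything below is CONDITIONAL on displayed named facts and on the per-pair
certificate `μ^an(E,p) = 0` (Greenberg's `μ`-conjecture at class level, barrier B3). BSD is not proved
for any curve or class by this file. beyond-print theorem: no.

## What

The x11a chain of record `X11a.forall_bsdp_of_namedFacts_ofLevel_heightFree` (`X11a/ChainAnyLevel.lean`):
on X11a ∩ {`p ≥ 5`, `ρ̄_{E,p}` SURJECTIVE}, `MuAnZeroAt W p ⟹ BSD(E,p)` from 12 named facts — uses
surjectivity only through (K) Kato–Wuthrich A32 and (W) the typed instance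
`Wan2015.thm4_rational_weightK_member_of_bdd_ofLevel` of Wan 2015 Thm. 4 (restricted by the b2b
literature seat to surjective `ρ̄_{E,p}`). (K) was re-based on the typed divisibility
`X11b.MultDivisibilityAt` in `Theorems/PrintX11aLowerHalfNonSurjEndpoint.lean` (p607778), supplied on
the non-surjective sub-leaf by ty2 ∕ corner-p1's `ClassX11a.multDivisibilityAt_of_muAnZeroAt_of_not_surj`
(Kato 2004 Thm. 12.4 + §17.13 fine quotient + Greenberg 1999 Thm. 1.5 + Wuthrich 2014 Cor. 18: the
μ-transfer WITHOUT big image). (W): Wan's theorem is PRINTED under "(irred) and (dist)" only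
(Forum Math. Sigma 3 (2015) e18, Thm. 4 pp. 4–5 = Thm. 103 pp. 91–92) — `ρ̄_f` IRREDUCIBLE, not
surjective; the Literature twin `Wan2015.thm4_rational_weightK_member_of_bdd_ofLevel_irred` (p608784; binder
`W.HasIrreducibleModPGaloisRep p` in place of `W.HasSurjectiveModNGaloisRep p`, otherwise byte-identical to
the level-generic Surj instance, which it implies — §0 `thm4_irred_to_ofLevel`) types that instance, with
the discharge of the un-printed Fujiwara hypothesis (H1) on the instance recorded in its docstring (BCS 2025
Lemma 5.2.3's inertia argument; at `p ‖ N` an irreducible non-surjective image is the FULL split-Cartan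
normaliser or `5S4`, whose `SL₂`-part is absolutely irreducible).

* §0 `thm4_irred_to_ofLevel` (bookkeeping: the (irred) instance implies the Surj instance).
* §1 `muAnZeroAt_of_allowableRootShape` — the K2 ∕ p3 «allowable root» currency of the certificate
  (the body of `Theorems.NonSurjCornerTwinMuAn` = item 19948 and of `Theorems.X11aNonSurjMuAn`) gives
  `X11a.MuAnZeroAt W p` (pure logic + `isMultPAdicLFunctionOf_one_iff`).
* §2 `invariantsAt_normLam_of_memberOfLevel_bdd_of_multDivisibilityAt` — the ¬Surj twin of
  `X11a.Chain.invariantsAt_normLam_of_memberOfLevel_bdd`: SAME proof with `hirr` for `hsurj`, the E-side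
  `μ^alg = 0` from `NonSurjChain.isTorsion_and_mu_eq_zero_of_muAnZeroAt_of_multDivisibilityAt` (p607778)
  instead of Kato A32, and §0's (irred) instance for `hT2`;
  `invariantsMatchAt_of_modularity_ofLevel_of_multDivisibilityAt` (member + parametrisation from
  `exists_isNewformOf`). Part B composes with p607778's endpoint: at a non-surjective X11a pair with
  `p ≥ 5`, `μ^an(E,p) = 0 ⟹ Mazur's main conjecture ⟹ BSD(E,p) ⟹ the lower half`, modulo named facts.

References: [Wan2015] Thm. 4 (pp. 4–5) = Thm. 103 (pp. 91–92), Thm. 8 (pp. 6–7), proof of Thm. 103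
(p. 92); [BurungaleCastellaSkinner2025] Hyp. 3.1.1, Rem. 3.1.2, Lemma 5.2.3 (arXiv:2405.00270 pp. 7,
10); [EmertonPollackWeston2006] Thm. 1, Thm. 3.1.1, Thm. 5.1.3; [Kato2004Asterisque] Thm. 12.4,
§17.13; [Wuthrich2014] Cor. 18; [Serre1972] §2.4 Prop. 15, §2.6; cell files
`pub/bsd-print-x11a/P3-EXCEPTIONAL-ZERO-ROAD.md` §5–§6, `pub/bsd-stepL/line-er5-p2/`.
-/

set_option autoImplicit false
set_option linter.dupNamespace false -- the directory name repeats the summit name (sibling precedent)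

noncomputable section

open scoped Classical MatrixGroups ModularForm

open CongruenceSubgroup WeierstrassCurve Literature.NumberTheory.EllipticCurves
  Literature.NumberTheory.EllipticCurves.ModularForms
  Literature.NumberTheory.EllipticCurves.Rank1Residual
  Literature.NumberTheory.EllipticCurves.Rank1Residual.Typed
  Literature.NumberTheory.EllipticCurves.Wuthrich2014
  Literature.NumberTheory.EllipticCurves.SteinWuthrich2013
  Literature.NumberTheory.EllipticCurves.Greenberg1999
  Literature.NumberTheory.EllipticCurves.Kato2004
  Literature.NumberTheory.EllipticCurves.GreenbergVatsal2000
  Literature.NumberTheory.EllipticCurves.EmertonPollackWeston2006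
  Literature.NumberTheory.EllipticCurves.BalakrishnanEtAl2019
  Literature.NumberTheory.GaloisRepresentations
  Summit.BirchSwinnertonDyer.Rank1Residual
  Summit.BirchSwinnertonDyer.Rank1Residual.X1.MuLambda
  Summit.BirchSwinnertonDyer.Rank1Residual.X11a
  Summit.BirchSwinnertonDyer.Rank1Residual.X11a.LambdaNorm
  Summit.BirchSwinnertonDyer.Rank1Residual.X11a.Chain

namespace Summit.BirchSwinnertonDyer.BirchSwinnertonDyer.Theorems.NonSurjChain

/-! ### §0 Bookkeeping for the named fact (Literature): Wan 2015 Thm. 4 (rational part) under (irred) -/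

/-- The (irred) instance `Wan2015.thm4_rational_weightK_member_of_bdd_ofLevel_irred` (Literature; Wan's
PRINTED image hypothesis) IMPLIES the tree's Surj instance `Wan2015.thm4_rational_weightK_member_of_bdd_ofLevel`
(a surjective `ρ̄_{E,p}` is irreducible: `hasIrreducibleModPGaloisRep_of_hasSurjectiveModNGaloisRep`) — the
new fact only WEAKENS a hypothesis of the typed statement. Bookkeeping. [cite: Wan2015, Thm. 4 (pp. 4–5) = Thm. 103 (pp. 91–92)] -/
theorem thm4_irred_to_ofLevel (h : Wan2015.thm4_rational_weightK_member_of_bdd_ofLevel_irred) :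
    Wan2015.thm4_rational_weightK_member_of_bdd_ofLevel := by
  intro W _ _ p _ hp hmult hsurj M _ hpM k g ι hmem 𝔇 κ γ hκ hγ hγ' D htors G hG Dsym L hL hbdd
  exact h W p hp hmult (hasIrreducibleModPGaloisRep_of_hasSurjectiveModNGaloisRep W p hsurj) hpM g ι hmem
    𝔇 κ γ hκ hγ hγ' D htors G hG Dsym L hL hbdd

/-! ### §1 The certificate in the K2 ∕ p3 «allowable root» currency gives `X11a.MuAnZeroAt` -/

section Certificate

variable (W : WeierstrassCurve ℚ) [W.IsElliptic] [W.IsGloballyMinimal] (p : ℕ) [Fact p.Prime]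

/-- **The «allowable root» form of the certificate gives `X11a.MuAnZeroAt W p`** (pure logic): the body of
`Theorems.NonSurjCornerTwinMuAn` ∕ `Theorems.X11aNonSurjMuAn` at a pair quantifies over `a ∈ ℚ_p` with
`split → a = 1`, `¬split → a = −1` and `IsMultPAdicLFunctionOf f p a L`; at a split prime
`IsMultPAdicLFunctionOf f p 1 L ↔ IsSplitMultPAdicLFunctionOf f p L` (`isMultPAdicLFunctionOf_one_iff`),
at a non-split prime take `a = −1`. [cite: MazurTateTeitelbaum1986, §I.10 and §I.14 (allowable root a_p at p ∥ N)]
[cite: GreenbergLNM1716, Conj. 1.11 (shape only)] -/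
theorem muAnZeroAt_of_allowableRootShape
    (h : ∀ {N : ℕ} [NeZero N] (f : CuspForm (Gamma0 N) 2), IsNewformOf W f →
      ∀ (ϖ : ℚ), (ϖ : ℝ) * W.realPeriodRat = plusPeriod f →
      ∀ (a : ℚ_[p]) (L : PowerSeries ℚ_[p]),
        (W.HasSplitMultiplicativeReductionAtPrime p → a = 1) →
        (¬ W.HasSplitMultiplicativeReductionAtPrime p → a = -1) →
        IsMultPAdicLFunctionOf f p a L →
        ∃ n : ℕ, ‖PowerSeries.coeff n (PowerSeries.C ((ϖ : ℚ) : ℚ_[p]) * L)‖ = 1) :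
    X11a.MuAnZeroAt W p := by
  intro N _ f hf ϖ hϖ
  refine ⟨fun hns L hL => ?_, fun hs L hL => ?_⟩
  · exact h f hf ϖ hϖ (-1) L (fun hs => absurd hs hns) (fun _ => rfl) hL
  · exact h f hf ϖ hϖ 1 L (fun _ => rfl) (fun hns => absurd hs hns)
      ((isMultPAdicLFunctionOf_one_iff L).mpr hL)

end Certificate

/-! ### §2 The Hida-family chain at a pair WITHOUT surjectivity -/

section Chain

variable (W : WeierstrassCurve ℚ) [W.IsElliptic] [W.IsGloballyMinimal] (p : ℕ) [Fact p.Prime]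

/-- **The chain at a pair on the level-generic (bounded) Wan ∕ EPW facts, NO surjectivity**: `E[p]`
irreducible (`hirr`), the typed divisibility `X11b.MultDivisibilityAt W p` (`hdiv`) in place of
Kato–Wuthrich A32, and §0's (irred) instance of Wan's Thm. 4 (`hT2`); otherwise VERBATIM the proof of
`X11a.Chain.invariantsAt_normLam_of_memberOfLevel_bdd`: [L1] the weight-`k = (p−1)+2` member at its own
level (`hMemW`), (E1) ordinary `p`-adic data (Deligne–Serre 6.1 `h61` + Hida/Wiles 3.26 `h326`), Shimura's
datum, THE bounded `p`-adic `L`-function (`exists_isCycPAdicLFunctionWeightK_holds`); [L4] `μ^alg(E) = 0`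
for every cyclotomic ∕ dual datum from the certificate and `hdiv`
(`NonSurjChain.isTorsion_and_mu_eq_zero_of_muAnZeroAt_of_multDivisibilityAt`); (E2)/(E3) dual datum +
principal generator; EPW Thm. 3.1.1 (`h311`), Thm. 1 alg (`hT1a`), Wan Thm. 4 rational (`hT2`):
`λ^alg(g) = λ^an(g)`; EPW Thm. 5.1.3 (`hT1b`) at the Kato pair. Conclusion: every Kato pair has unit
contents and `normLam gK = normLam fE`. [cite: EmertonPollackWeston2006, p. 2 (H(ρ̄)), Thm. 1, Thm. 3.1.1, Thm. 5.1.3]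
[cite: Wan2015, Thm. 4 (pp. 4–5) = Thm. 103 (pp. 91–92)] [cite: Kato2004Asterisque, §17.13 (pp. 279–280)] -/
theorem invariantsAt_normLam_of_memberOfLevel_bdd_of_multDivisibilityAt
    (hMemW : ∀ (k : ℤ), 2 < k → ((p : ℤ) - 1) ∣ (k - 2) →
      ∃ (M : ℕ) (_ : NeZero M) (_ : ¬ p ∣ M) (g : CuspForm (Gamma0 M) k)
        (ι : coeffField g →+* PadicAlgCl p), IsOrdinaryMemberOfLevel W p g ι)
    (h311 : thm311_cotorsion_weightK_member_ofLevel) (hT1a : thm1_muAlg_of_weightK_member_ofLevel)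
    (hT2 : Wan2015.thm4_rational_weightK_member_of_bdd_ofLevel_irred)
    (hT1b : thm513_transfer_from_weightK_member_of_bdd_ofLevel)
    (h61 : DeligneSerre1974.thm61_exists_adicGaloisRep) (h326 : Hida2000_thm326_ordinary)
    (hpar : nonempty_modularParametrizationData)
    (hp : 5 ≤ p) (hmult : W.HasMultiplicativeReductionAtPrime p)
    (hirr : W.HasIrreducibleModPGaloisRep p) (hdiv : X11b.MultDivisibilityAt W p)
    (hμ : MuAnZeroAt W p) :
    InvariantsAt W p fun gK fE => HasUnitContent gK ∧ HasUnitContent fE ∧ normLam gK = normLam fE := by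
  -- adapted from `X11a.Chain.invariantsAt_normLam_of_memberOfLevel_bdd` (X11a/ChainAnyLevel.lean)
  have hprime : p.Prime := Fact.out
  have hp2 : p ≠ 2 := by omega
  haveI : NeZero p := ⟨hprime.ne_zero⟩
  -- [L1]: the weight-`k` member, `k = (p − 1) + 2`, at its own level `M`, `p ∤ M`
  set n : ℕ := p - 1 with hn
  have hn0 : n ≠ 0 := by omega
  have hneven : Even n := hn ▸ hprime.even_sub_one hp2
  have hk2 : (2 : ℤ) < (n : ℤ) + 2 := by omega
  have hkdvd : ((p : ℤ) - 1) ∣ ((n : ℤ) + 2 - 2) := by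
    refine ⟨1, ?_⟩
    rw [hn, Nat.cast_sub hprime.one_le]; push_cast; ring
  obtain ⟨M, _instM, hpM, g, ι, hmem⟩ := hMemW ((n : ℤ) + 2) hk2 hkdvd
  have hg : IsNewform0 g := hmem.2.2.1
  -- (E1) the ordinary `p`-adic data; Shimura's datum; THE bounded `p`-adic `L`-function
  obtain ⟨𝔇⟩ := OrdinaryPadicData.nonempty_of_thm61_of_thm326 h61 h326 g hg (by omega) p hpM ι
    hmem.2.2.2.1
  obtain ⟨Dsym⟩ := IsNewform0.nonempty_periodSymbolDatum hneven hn0 hg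
  obtain ⟨L, hL, hbd, -⟩ :=
    exists_isCycPAdicLFunctionWeightK_holds g hg (by omega) p hpM ι 𝔇.υ 𝔇.υ_root 𝔇.norm_υ Dsym
  -- [L4]: `μ(X(E/ℚ_∞)) = 0` for every cyclotomic / dual datum, from the certificate and `hdiv`
  have hμalg : ∀ (κ : ZpExtension ℚ p) (γ : Field.absoluteGaloisGroup ℚ), κ.IsCyclotomic →
      κ.IsTopGenerator γ → IsCyclotomicVariable p γ →
      ∀ D' : W.SelmerDualData κ γ, D'.IsTorsion ∧ D'.mu = 0 :=
    fun κ γ hκ hγ hγ' D' =>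
      isTorsion_and_mu_eq_zero_of_muAnZeroAt_of_multDivisibilityAt W p hpar hmult hdiv hμ hκ hγ hγ' D'
  -- the conclusion's own cyclotomic datum serves the `g`-side
  intro κ γ hκ hγ hγ' N _ f hf D' ϖ hϖ fE gK hchar
  -- (E2) the dual datum; EPW Thm. 3.1.1 (cotorsion); (E3) a principal generator
  obtain ⟨D⟩ := GreenbergSelmer.nonempty_dualData (memberGenerators g ι 𝔇.υ) κ hγ 𝔇.ρ 𝔇.plus
  obtain ⟨hfin, htors⟩ := h311 W p hp hmult hirr hpM g ι hmem 𝔇 κ γ hκ hγ D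
  haveI : FiniteDimensional ℚ_[p] (padicCoeffField (memberGenerators g ι 𝔇.υ)) :=
    finiteDimensional_padicCoeffField_memberGenerators hg ι 𝔇.υ
  obtain ⟨G, hG⟩ :=
    (GreenbergSelmer.DualData.isPrincipal_charIdeal (memberGenerators g ι 𝔇.υ) D).principal
  -- EPW Thm. 1 (alg): `μ^alg(g) = 0`
  have hμg := hT1a W p hp hmult hirr hμalg hpM g ι hmem 𝔇 κ γ hκ hγ hγ' D htors G hG
  -- Wan Thm. 4 (irred instance): `L = c · u · G`, hence `λ^alg(g) = λ^an(g)`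
  obtain ⟨c, u, hc, hLcuG⟩ :=
    hT2 W p hp hmult hirr hpM g ι hmem 𝔇 κ γ hκ hγ hγ' D htors G hG Dsym L hL hbd
  have hlam : normLam (PowerSeries.map (padicCoeffIntegers (memberGenerators g ι 𝔇.υ)).subtype G) =
      normLam L := by
    obtain ⟨hU0, hU⟩ := map_unit_integral u
    obtain ⟨hGmax, hG0⟩ := hasMaxCoeff_map_of_exists_norm_eq_one hμg
    rw [hLcuG, normLam_C_mul (norm_ne_zero_iff.mpr hc), map_mul,
      normLam_mul_of_integral_unit hU0 hU hGmax hG0]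
  -- EPW Thm. 5.1.3 (+ 4.4.5 with the certificate), at the Kato pair
  exact hT1b W p hp hmult hirr hpM g ι hmem 𝔇 κ γ hκ hγ hγ' D htors G hG Dsym L hL hbd hμg hlam hμ κ
    γ hκ hγ hγ' f hf D' ϖ hϖ fE gK hchar

/-- **EPW's invariants statement `X11a.InvariantsMatchAt W p` at a multiplicative `p ≥ 5` with `E[p]`
irreducible (ANY image), from the certificate, the typed divisibility and the named facts** — the
Hida-family member and the modular parametrisation both from the Modularity Theorem
(`hNf : exists_isNewformOf`; `X11a.Chain.exists_memberOfLevel_of_exists_isNewformOf`,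
`nonempty_modularParametrizationData_of_exists_isNewformOf`). [cite: EmertonPollackWeston2006, Thm. 1, Thm. 3.1.1, Thm. 5.1.3]
[cite: Wan2015, Thm. 4] [cite: BreuilConradDiamondTaylor2001, Thm. A and p. 845 (2) ⇒ (6)] -/
theorem invariantsMatchAt_of_modularity_ofLevel_of_multDivisibilityAt (hNf : exists_isNewformOf)
    (h311 : thm311_cotorsion_weightK_member_ofLevel) (hT1a : thm1_muAlg_of_weightK_member_ofLevel)
    (hT2 : Wan2015.thm4_rational_weightK_member_of_bdd_ofLevel_irred)
    (hT1b : thm513_transfer_from_weightK_member_of_bdd_ofLevel)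
    (h61 : DeligneSerre1974.thm61_exists_adicGaloisRep) (h326 : Hida2000_thm326_ordinary)
    (hp : 5 ≤ p) (hmult : W.HasMultiplicativeReductionAtPrime p)
    (hirr : W.HasIrreducibleModPGaloisRep p) (hdiv : X11b.MultDivisibilityAt W p)
    (hμ : MuAnZeroAt W p) : InvariantsMatchAt W p :=
  invariantsMatchAt_of_invariantsAt_normLam W p
    (invariantsAt_normLam_of_memberOfLevel_bdd_of_multDivisibilityAt W p
      (exists_memberOfLevel_of_exists_isNewformOf W p hNf hp hmult) h311 hT1a hT2 hT1b h61 h326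
      (nonempty_modularParametrizationData_of_exists_isNewformOf hNf
        IsNewformOf.exists_maninConstant_ne_zero_holds)
      hp hmult hirr hdiv hμ)

end Chain

end Summit.BirchSwinnertonDyer.BirchSwinnertonDyer.Theorems.NonSurjChain

end
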